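import Literature.AnabelianGeometry.AbsoluteAnabelian.AbsTopIProp23iGFGSurfaceModel
import Mathlib.GroupTheory.GroupAction.ConjAct
import HarnessLib

/-!
# [AbsTopI] Def 2.1 (i): the almost pro-`Σ`-maximal quotient EXISTS (non-vacuity of the GFG surface model)

S. Mochizuki, *Topics in Absolute Anabelian Geometry I: Generalities* (2012) [AbsTopI] (lit key
`paper:url-11ac98ba15fc`), Def 2.1 (i) p. 17: given `π₁(X_k̄)` and a finite étale Galois `Y → X`, "`π₁(X_k̄) ↠ Δ_X`
an almost pro-`Σ`-maximal quotient of `π₁(X_k̄)` whose kernel is normal … such that the kernel of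
`Δ_X → Gal(Y/X)` is pro-`Σ`; thus `Ker(Δ_X → Gal(Y/X))` may be identified with the maximal pro-`Σ` quotient of
`Ker(π₁(X_k̄) → Gal(Y/X))`".  PROOF-ONLY file (no definition, no named fact) CONSTRUCTING this quotient for
an arbitrary profinite `P` and open normal `U ⊴ P`, so that the hypotheses of the GFG surface model
(`AbsTopIProp23iGFGSurfaceModel.lean`, p440186: `π : P ↠ D` continuous, `ker π ≤ U`,
`IsMaxProSigmaQuotient Σ (π|_U : U ↠ π(U))`) are INHABITED for every `(P, U, Σ)` — not only at `U = ⊤`: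

* `map_subtype_normal_of_isMaxProSigmaQuotient` — the kernel `K_Σ(U) ⊴ U` of the maximal pro-`Σ` quotient of an
  open normal `U ⊴ P` is NORMAL IN `P` (it is topologically characteristic in `U`:
  `IsMaxProSigmaQuotient.map_ker_eq` applied to conjugation by `p ∈ P`);
* `exists_gfgQuotient` — **the quotient `D := P ⧸ K_Σ(U)` with `π = mk` satisfies: `K_Σ(U)` closed, normal,
  `≤ U`, and `π|_U : U ↠ π(U)` presents the maximal pro-`Σ` quotient of `U`**;
* `exists_slim_and_elastic_gfgQuotient` — hence, for `P` a pro-`Σ′` completion of `S_g` (`g ≥ 2`, `Σ ⊆ Σ′ ∋` a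
  prime of `Σ`), EVERY open normal `U` yields an almost pro-`Σ` GFG quotient `D` of `P` which is slim, elastic
  and without nontrivial finite normal subgroups (p440186 (T3)(T4) at the constructed data).

Classical profinite group theory; OUR kernel check; nothing here bears on [IUTchIII] Cor. 3.12.
-/

noncomputable section

open Topology

universe u

namespace Literature.AnabelianGeometry.AbsoluteAnabelian

namespace GFGSurfaceModel

open Literature.AlgebraicGeometry.Frobenioids (IsSlimGroup)
open Literature.AnabelianGeometry.Anabelioids (IsSigmaInteger)
open Literature.AnabelianGeometry.SemiGraphs (IsProSigma)
open Literature.AnabelianGeometry.SemiGraphs.PSCDatum (IsMaxProSigmaQuotient exists_isMaxProSigmaQuotient)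
open Literature.AnabelianGeometry.SemiGraphs.SemiGraphOfAnabelioids
open Literature.GroupTheory.CombinatorialGroupTheory
open Literature.GroupTheory.ProfiniteSubquotients
open Literature.Topology.FourManifolds (SurfaceGroup)

variable {Sigma : Set ℕ} {P : Type u} [Group P] [TopologicalSpace P] [IsTopologicalGroup P] [CompactSpace P]
  [TotallyDisconnectedSpace P]

omit [CompactSpace P] [TotallyDisconnectedSpace P] in
/-- **`K_Σ(U)` is normal in `P`**: for an open normal `U ⊴ P` and a presentation `f : U ↠ Q` of the maximal
pro-`Σ` quotient of `U` (`Q` profinite), the image of `ker f` in `P` is a normal subgroup of `P` — `ker f` is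
carried to itself by every topological automorphism of `U` (`IsMaxProSigmaQuotient.map_ker_eq`), in particular by
conjugation by `p ∈ P` (Mathlib `MulAut.conjNormal`, continuous). [cite: MochizukiAbsTopI2012, Def 2.1 (i) p.17] -/
theorem map_subtype_normal_of_isMaxProSigmaQuotient {Q : Type u} [Group Q] [TopologicalSpace Q]
    [IsTopologicalGroup Q] [CompactSpace Q] [TotallyDisconnectedSpace Q] (U : Subgroup P) [U.Normal]
    {f : U →* Q} (hf : IsMaxProSigmaQuotient Sigma f) : (f.ker.map U.subtype).Normal := by
  refine ⟨fun x hx p => ?_⟩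
  obtain ⟨k, hk, rfl⟩ := Subgroup.mem_map.mp hx
  -- conjugation by `p` as a topological automorphism of `U`
  let α : U ≃ₜ* U :=
    { MulAut.conjNormal p with
      continuous_toFun := by
        refine Continuous.subtype_mk ?_ _
        exact ((continuous_const.mul continuous_subtype_val).mul continuous_const)
      continuous_invFun := by
        refine Continuous.subtype_mk ?_ _
        exact ((continuous_const.mul continuous_subtype_val).mul continuous_const) }
  have hα : ∀ u : U, ((α u : U) : P) = p * u * p⁻¹ := fun u => MulAut.conjNormal_apply p u
  have hfix : f.ker.map α.toMulEquiv.toMonoidHom = f.ker := hf.map_ker_eq hf α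
  have hmem : α k ∈ f.ker := by
    rw [← hfix]
    exact Subgroup.mem_map_of_mem _ hk
  refine Subgroup.mem_map.mpr ⟨α k, hmem, ?_⟩
  rw [Subgroup.coe_subtype, hα]

/-- **Existence of the almost pro-`Σ`-maximal quotient relative to an open normal `U ⊴ P`** ([AbsTopI] Def 2.1
(i)): there is a closed normal subgroup `K ≤ U` of `P` (namely `K_Σ(U)`) such that, for `D := P ⧸ K` and
`π := mk`, the restriction `π|_U : U ↠ π(U)` presents the maximal pro-`Σ` quotient of `U`.  Thus the data of
`GFGSurfaceModel.centralizer_map_eq_bot` exist for every profinite `P`, open normal `U` and `Σ`.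
[cite: MochizukiAbsTopI2012, Def 2.1 (i) p.17] -/
theorem exists_gfgQuotient (Sigma : Set ℕ) (U : Subgroup P) [U.Normal] (hUo : IsOpen (U : Set P)) :
    ∃ (K : Subgroup P) (_ : K.Normal), IsClosed (K : Set P) ∧ K ≤ U ∧
      IsMaxProSigmaQuotient Sigma ((QuotientGroup.mk' K).subgroupMap U) := by
  haveI : CompactSpace U := compactSpace_of_isOpen hUo
  obtain ⟨K₀, hK₀n, hK₀c, hf⟩ := exists_isMaxProSigmaQuotient Sigma (P := U)
  haveI := hK₀n
  haveI : IsClosed ((K₀ : Subgroup U) : Set U) := hK₀c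
  haveI : TotallyDisconnectedSpace (U ⧸ K₀) := totallyDisconnectedSpace_quotient K₀ hK₀c
  have hkerf : (QuotientGroup.mk' K₀).ker = K₀ := QuotientGroup.ker_mk' K₀
  let K : Subgroup P := K₀.map U.subtype
  haveI hKn : K.Normal := by
    have h := map_subtype_normal_of_isMaxProSigmaQuotient U hf
    rwa [hkerf] at h
  have hKc : IsClosed (K : Set P) := by
    have : (K : Set P) = ((↑) : U → P) '' (K₀ : Set U) := Subgroup.coe_map U.subtype K₀
    rw [this]
    exact (U.isClosed_of_isOpen hUo).isClosedMap_subtype_val _ hK₀c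
  have hKU : K ≤ U := by
    rintro _ ⟨k, _, rfl⟩
    exact k.2
  refine ⟨K, hKn, hKc, hKU, ?_⟩
  set π : P →* P ⧸ K := QuotientGroup.mk' K with hπ
  -- the kernel of `π|_U` is `K₀`
  have hkerπU : (π.subgroupMap U).ker = K₀ := by
    ext u
    rw [MonoidHom.mem_ker]
    constructor
    · intro h
      have h' : π (u : P) = 1 := by simpa using congrArg Subtype.val h
      rw [hπ, QuotientGroup.mk'_apply, QuotientGroup.eq_one_iff] at h'
      obtain ⟨k, hk, hku⟩ := Subgroup.mem_map.mp h'
      rwa [← Subtype.ext hku]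
    · intro h
      apply Subtype.ext
      have h' : π (u : P) = 1 := by
        rw [hπ, QuotientGroup.mk'_apply, QuotientGroup.eq_one_iff]
        exact Subgroup.mem_map_of_mem _ h
      simpa using h'
  -- `U ⧸ K₀ → π(U)`, continuous and surjective, transports pro-`Σ`
  have hle : K₀ ≤ (π.subgroupMap U).ker := hkerπU.symm.le
  let θ : U ⧸ K₀ →* (U.map π) := QuotientGroup.lift K₀ (π.subgroupMap U) hle
  have hπUc : Continuous (π.subgroupMap U) :=
    Continuous.subtype_mk (QuotientGroup.continuous_mk.comp continuous_subtype_val) _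
  have hθc : Continuous θ := by
    rw [(QuotientGroup.isQuotientMap_mk K₀).continuous_iff]
    exact hπUc
  have hθs : Function.Surjective θ := by
    intro y
    obtain ⟨u, rfl⟩ := MonoidHom.subgroupMap_surjective π U y
    exact ⟨QuotientGroup.mk u, rfl⟩
  refine ⟨hπUc, MonoidHom.subgroupMap_surjective π U, hf.proSigma.of_surjective θ hθc hθs, ?_⟩
  intro N hNn hNo hNS
  rw [hkerπU, ← hkerf]
  exact hf.ker_le N hNn hNo hNS

/-- **Non-vacuity of [AbsTopI] Prop 2.3 (i) at the GFG construction**: for `P` a pro-`Σ′` completion of a closed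
surface group `S_g` (`g ≥ 2`), `Σ ⊆ Σ′` containing a prime, and ANY open normal `U ⊴ P`, the almost
pro-`Σ`-maximal quotient `D = P ⧸ K_Σ(U)` of Def 2.1 (i) is slim and elastic and has no nontrivial finite normal
subgroup (`GFGSurfaceModel.slim_and_elastic` / `forall_finite_normal_eq_bot`, p440186, at the data of
`exists_gfgQuotient`). [cite: MochizukiAbsTopI2012, Prop 2.3 (i) p.19] -/
theorem exists_slim_and_elastic_gfgQuotient [T2Space P] {Sigma' : Set ℕ} (hSS : Sigma ⊆ Sigma')
    (hS : ∃ ℓ ∈ Sigma, ℓ.Prime) {Γ : Type*} [Group Γ] {g : ℕ} (hg : 2 ≤ g) (e : Γ ≃* SurfaceGroup g)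
    {j : Γ →* P} (hj : IsProSigmaCompletion Sigma' j) (U : Subgroup P) [U.Normal] (hUo : IsOpen (U : Set P)) :
    ∃ (K : Subgroup P) (_ : K.Normal) (_ : IsClosed (K : Set P)), K ≤ U ∧
      IsMaxProSigmaQuotient Sigma ((QuotientGroup.mk' K).subgroupMap U) ∧
      IsSlimGroup (P ⧸ K) ∧ IsElastic (P ⧸ K) ∧
      ∀ N : Subgroup (P ⧸ K), N.Normal → (N : Set (P ⧸ K)).Finite → N = ⊥ := by
  obtain ⟨K, hKn, hKc, hKU, hmax⟩ := exists_gfgQuotient Sigma U hUo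
  haveI := hKn
  haveI : IsClosed ((K : Subgroup P) : Set P) := hKc
  haveI : TotallyDisconnectedSpace (P ⧸ K) := totallyDisconnectedSpace_quotient K hKc
  have hker : (QuotientGroup.mk' K).ker ≤ U := by rw [QuotientGroup.ker_mk']; exact hKU
  obtain ⟨hs, he⟩ := slim_and_elastic hSS hS hg e hj hUo QuotientGroup.continuous_mk
    (QuotientGroup.mk'_surjective K) hker hmax
  exact ⟨K, hKn, hKc, hKU, hmax, hs, he, forall_finite_normal_eq_bot hSS hS hg e hj hUo
    QuotientGroup.continuous_mk (QuotientGroup.mk'_surjective K) hker hmax⟩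

end GFGSurfaceModel

end Literature.AnabelianGeometry.AbsoluteAnabelian

end
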